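import Literature.MathematicalPhysics.QuantumFieldTheory.Balaban1983to89.B9MultiscaleSmoothPartitionYLip
import Literature.MathematicalPhysics.QuantumFieldTheory.Balaban1983to89.B11SectGSmoothCut
import Literature.MathematicalPhysics.QuantumFieldTheory.Balaban1983to89.B9CoReadingCoordsHolderS

/-!
# `Balaban1983to89.B9SmoothHolderClassS` — THE SMOOTH-PARTITION HÖLDER CLASS OF THE SITE COORDINATE CARRIER: n06-w6's generic (F1) block norm
# `B11SectGSmoothCut.BlockNorm.ofSmoothPartition` INSTANTIATED at def-Y's k-level index with the multiscale partition of unity `zeta` of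
# `B9MultiscaleSmoothPartitionY` — a `BlockNorm (toB6 (geo9K i) R H) (XSK κ i → ℝ)` with MEMBER-UNIFORM cutting cost `κ = 1 + C_Lip(d, L)` (a candidate pin for the
# free Hölder intermediates `bH13` ∕ `bXH` of rows 20–21, site sector)

T. Bałaban, *Propagators for lattice gauge theories in a background field*, Commun. Math. Phys. **99** (1985) 389–434
[`Balaban1985BackgroundPropagators`, "B9"]; [4] = T. Bałaban, *Propagators and renormalization transformations for lattice gauge
theories. II*, Commun. Math. Phys. **96** (1984) 223–250 [`Balaban1984PropagatorsII`].

statement-level skeleton of published theorems with citation tags; proofs where landed; nothing here is a claim about the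
Yang–Mills mass gap

THE PRINTED LOCI.  [B9] (3.40) p. 397 (the Hölder quotient over pairs *"x, x′ ∈ Δ̃(y), |x − x′| ≦ 1"*), (3.43)–(3.45) p. 398 (*"ζ ∈ C₀^∞(Δ̃(y))"*, the cost
*"(Lʲη)^{−α}(‖ζ‖^ξ_α + |ζ|)"*, inputs *"supp λ ⊂ Δ̃(y′) … (‖λ‖_{α+ε} + |λ|)"*); [4] (2.51)–(2.52) p. 232, (2.67) p. 234 (the torus Hölder seminorm `‖·‖_α`).

WHY THIS FILE (cell `pub-ymgap`, node N06, seat dag-n06-l g20; the third piece after `B9MultiscaleSmoothPartitionY` ∕ `…YLip`).  The located architecture item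
«SHARP-CUT JUMPS ∕ bH13 ∕ bXH ∕ hκX» asks for a block norm in which a Hölder-type intermediate is produced, consumed AND cut with a member-uniform `κ`.  n06-w6's
`BlockNorm.ofSmoothPartition N P w hw W hW ζ Λ …` is that norm GIVEN a partition of unity; `B9MultiscaleSmoothPartitionY(Lip)` is the partition.  THIS FILE assembles
the two at the site coordinate carrier `XSK κ i = SiteY i × (Fin (d+1) × κ × κ)` of n06-d's coordinate model, with the following choices (OURS — recorded for the pin
owner, each can be varied without touching the datum):
* neighbourhoods `N y p := NearY i y p.1` (the enlarged carrier block `Δ̃(y)`: radial coordinate `< 3`);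
* pair domain `NearPair i p q`: DISTINCT sites within torus distance `L^{lev p.1}` of the base point and the SAME coordinate slot (`p.2 = q.2`) — print's
  *"x, x′ ∈ Δ̃(y), |x − x′| ≦ 1"*; a LOCAL pair domain is what lets a producer's majorant into the class decay in `d(y, y′)` (a far partner `x′` near `Δ(y′)` would
  otherwise contribute `|Tμ(x′)| ~ |μ|` to `loc_y`);
* pair weight `wEta i ε p q := ((|p − q|_T ∕ Lᵏ)^ε)⁻¹` (η-scale: print's `|x − x′|^{−α}` in physical units, `η = L^{−k}`; = n06-d's `wS ε` up to the order of the
  difference) and sup weight `Wscl i ε y := ((L^{j(y)} ∕ Lᵏ)^ε)⁻¹ = (Lʲη)^{−ε}` — print's displayed block-scale power; the datum's `scaledWeight_mul_abs_zeta_sub_le`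
  IS the scale-covariant binder `hLip … ≤ Λ·W y` with `Λ := C_Lip(d, L)`;
* `0 ≤ ε ≤ 1` (Hölder exponent) and a sup power `p ≥ ε` (`p = ε`: print's `𝔥^{(−ε)}`-type class; `p = 1`: the `(Lʲη)^{−1}`-weighted classes `bH13`∕`bXH` of rows 20–21).
CONTENT: §1 `NearPair`, `wEta`, `Wscl` (+ nonnegativity, `scl_div_nKT_pos_le_one`, `one_le_Wscl`, `Wscl_mono`); §2 ★★ `bHZ i hε0 hε1 hεp : BlockNorm (toB6 (geo9K i) R H) (XSK κ i → ℝ)` and its reading lemmas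
`bHZ_κ` (**`κ = 1 + CLip d ℓ`**, `rfl`), `bHZ_loc`, `bHZ_cut_apply` (`= zeta i y p.1 * F p`), `bHZ_isLoc_iff` (`F` vanishes off `Δ̃(y)`); §3 `bHZ_isLoc_of_blkOf`
(a vector supported over the carrier block `β y` is localised at `y` — the sharp classes' `IsLoc` implies the smooth one); §4 (v1.1 APPEND) the ξ-SCALE TWIN
`bHZxi ε p` (pair weight `wXi` in units of the base point's block scale, ANY sup power `p ≥ 0`, `Λ := L·C_Lip`; ★`wXi_mul_abs_zeta_sub_le`, `bHZxi_κ`, `bHZxi_isLoc_iff`).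
HONEST SCOPE.  A definition by instantiation + `rfl`-level readings; the producers INTO the class ((3.43)-type majorants at def-Y's letters) and the consumers OUT of
it ((3.44)∕(3.45)) are NOT here; the choices above are a proposal to the pin owner (dag-n06-d ∕ node00-def-Y), not a certificate edit; nothing of [B9]∕[4] asserted;
COUNT-NEUTRAL; N06 NOT discharged; nothing continuum, nothing about the mass gap.  Cell `pub-ymgap` (HUMAN RULING D-0062), Track A node N06 [B9], seat
`pub-ymgap-dag-n06-l` (g20), 2026-08-28.
-/

noncomputable section

namespace Literature.MathematicalPhysics.QuantumFieldTheory.Balaban1983to89.B9SmoothHolderClassS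

open B4TorusKernel.MultiPeriod (torusSupNorm torusSupNorm_nonneg)
open B6MultiLevelTorusOperator (one_le_N0)
open B6Geom246MultiLevelBox (blkOf)
open B6Ineq2142KLevelV1 (β lvl)
open B6KLevelCensusIndexV1 (KIdx)
open B6Prop22KLevelTorusCensusEta (nKT one_le_nKT one_le_torusSupNorm_sub)
open B9GeoNormsKLevelV1 (geo9K)
open B9Thm34Ext (toB6)
open B11SectG (BlockNorm)
open B11SectGGlobal (Size)
open B11SectGGlobalSizes
open B11SectGSmoothCut (ofSmoothPartition_loc ofSmoothPartition_cut_apply ofSmoothPartition_isLoc_iff)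
open B9CoReadingCoordsS (XSK)
open B9MultiscaleSmoothPartitionY (scl scl_pos one_le_scl zeta NearY zetaOn sum_zetaOn_of_fintype zetaOn_nonneg zetaOn_le_one zetaOn_eq_zero_of_not_nearY
  nearY_of_blkOf_eq)
open B9MultiscaleSmoothPartitionYLip (CLip CLip_nonneg scaledWeight_mul_abs_zeta_sub_le)
open Node00 (SiteY IBondY toKT levY)

variable {d ℓ : ℕ} {hd : 1 ≤ d + 1} {hL : Odd (ℓ + 1) ∧ 1 < ℓ + 1} {b₀ b₁ : ℝ}
variable {κ : Type} [Fintype κ] [DecidableEq κ]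

/-! ## §1 The pair domain and the two weights -/

section Weights

variable (i : KIdx d ℓ hd hL b₀ b₁)

/-- **NEAR PAIRS** of the site coordinate carrier: distinct sites within torus distance `L^{lev p}` of the base point, same coordinate slot (print's
*"x, x′ ∈ Δ̃(y), |x − x′| ≦ 1"*, the admissible pairs of def-Y's `Adm` read on sites). [cite: Balaban1985BackgroundPropagators, (3.40) p.397; Balaban1984PropagatorsII, (2.137) p.247] -/
def NearPair (p q : XSK κ i) : Prop :=
  p.1.1 ≠ q.1.1 ∧ torusSupNorm (toKT i).NB (p.1.1 - q.1.1) ≤ (((ℓ + 1 : ℕ) : ℝ)) ^ levY i p.1 ∧ p.2 = q.2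

/-- **THE η-SCALE PAIR WEIGHT** `((|z − z′|_T ∕ Lᵏ)^ε)⁻¹ = (η|z − z′|_T)^{−ε}` (the reciprocal denominator of def-Y's `hqS` ∕ [4]'s `hqTP`; n06-d's `wS ε` with the
difference taken base-first). [cite: Balaban1985BackgroundPropagators, (3.40) p.397; Balaban1984PropagatorsII, (2.67) p.234] -/
def wEta (ε : ℝ) (p q : XSK κ i) : ℝ := ((torusSupNorm (toKT i).NB (p.1.1 - q.1.1) / (nKT (toKT i) : ℝ)) ^ ε)⁻¹

omit [Fintype κ] [DecidableEq κ] in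
/-- `0 ≤ wEta`. [cite: Balaban1985BackgroundPropagators, (3.40) p.397, bookkeeping] -/
theorem wEta_nonneg (ε : ℝ) (p q : XSK κ i) : 0 ≤ wEta i ε p q :=
  inv_nonneg.2 (Real.rpow_nonneg (div_nonneg (torusSupNorm_nonneg (fun μ => one_le_N0 (toKT i).hMh (toKT i).hP μ) _) (Nat.cast_nonneg _)) _)

/-- **THE BLOCK-SCALE SUP WEIGHT** `((L^{j(y)} ∕ Lᵏ)^ε)⁻¹ = (Lʲη)^{−ε}` — print's displayed power of the block scale in the Hölder members.
[cite: Balaban1985BackgroundPropagators, (3.43) p.398 («(Lʲη)^{−α}»), dictionary] -/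
def Wscl (ε : ℝ) (y : IBondY i) : ℝ := ((scl i y / (nKT (toKT i) : ℝ)) ^ ε)⁻¹

/-- `0 ≤ Wscl`. [cite: Balaban1985BackgroundPropagators, (3.43) p.398, bookkeeping] -/
theorem Wscl_nonneg (ε : ℝ) (y : IBondY i) : 0 ≤ Wscl i ε y :=
  inv_nonneg.2 (Real.rpow_nonneg (div_nonneg (scl_pos i y).le (Nat.cast_nonneg _)) _)

/-- the block scale in units of `Lᵏ = η⁻¹` lies in `(0, 1]`: `0 < L^{j(y)}∕Lᵏ ≤ 1` (`j(y) ≤ k`). [cite: Balaban1984PropagatorsII, (2.1) p.224 («Lʲη ≦ 1»), bookkeeping] -/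
theorem scl_div_nKT_pos_le_one (y : IBondY i) : 0 < scl i y / (nKT (toKT i) : ℝ) ∧ scl i y / (nKT (toKT i) : ℝ) ≤ 1 := by
  have hs := scl_pos i y
  have hn : (0 : ℝ) < (nKT (toKT i) : ℝ) := by exact_mod_cast lt_of_lt_of_le Nat.zero_lt_one (one_le_nKT (toKT i))
  have hle : scl i y ≤ (nKT (toKT i) : ℝ) := by
    rw [scl, nKT, Nat.cast_pow]
    exact pow_le_pow_right₀ (by exact_mod_cast Nat.succ_le_succ (Nat.zero_le ℓ)) (B6Ineq2142KLevelV1.lvl_le i.hN i.D i.hk y)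
  exact ⟨div_pos hs hn, (div_le_one hn).2 hle⟩

/-- `1 ≤ Wscl` for `0 ≤ p`: `(Lʲη)^{−p} ≥ 1`. [cite: Balaban1984PropagatorsII, (2.1) p.224 («Lʲη ≦ 1»), bookkeeping] -/
theorem one_le_Wscl {p : ℝ} (hp : 0 ≤ p) (y : IBondY i) : 1 ≤ Wscl i p y := by
  obtain ⟨h0, h1⟩ := scl_div_nKT_pos_le_one i y
  exact one_le_inv_iff₀.2 ⟨Real.rpow_pos_of_pos h0 _, Real.rpow_le_one h0.le h1 hp⟩

/-- `Wscl` is monotone in the power: `ε ≤ p ⇒ (Lʲη)^{−ε} ≤ (Lʲη)^{−p}`. [cite: Balaban1984PropagatorsII, (2.1) p.224 («Lʲη ≦ 1»), bookkeeping] -/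
theorem Wscl_mono {ε p : ℝ} (hεp : ε ≤ p) (y : IBondY i) : Wscl i ε y ≤ Wscl i p y := by
  obtain ⟨h0, h1⟩ := scl_div_nKT_pos_le_one i y
  exact inv_anti₀ (Real.rpow_pos_of_pos h0 _) (Real.rpow_le_rpow_of_exponent_ge h0 h1 hεp)

end Weights

/-! ## §2 ★★ The smooth-partition Hölder class of the site coordinate carrier -/

section Class

variable (i : KIdx d ℓ hd hL b₀ b₁) [Fintype (geo9K i).Site]

open Classical in
/-- ★★ **THE SMOOTH-PARTITION HÖLDER CLASS `bHZ ε p` OF THE SITE COORDINATE CARRIER**: n06-w6's `BlockNorm.ofSmoothPartition` over `toB6 (geo9K i) R H` with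
`N y q := NearY i y q.1` (enlarged carrier block), `P := NearPair i`, `w := wEta i ε`, `W := Wscl i p` (`ε ≤ p`), the partition `ζ := zetaOn i Prod.fst` of
`B9MultiscaleSmoothPartitionY` and `Λ := CLip d ℓ` — every structural binder DISCHARGED (`hsum` by `sum_zetaOn_of_fintype`, `hsupp` by `zetaOn_eq_zero_of_not_nearY`, `hLip` by
`scaledWeight_mul_abs_zeta_sub_le` + `Wscl_mono`); `loc y F = (Lʲη)^{−p}·sup_{Δ̃(y)}|F| + sup_{near pairs based in Δ̃(y)} (η|z−z′|_T)^{−ε}|F(z,s) − F(z′,s)|`, `cut y F = ζ_y·F`,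
**`κ = 1 + C_Lip(d, L)`** member-uniform. [cite: Balaban1985BackgroundPropagators, (3.40) p.397 + (3.43)–(3.45) p.398; Balaban1984PropagatorsII, (2.51)–(2.52) p.232, (2.67) p.234] -/
def bHZ {R : ℝ} {H : Prop} {ε p : ℝ} (hε0 : 0 ≤ ε) (hε1 : ε ≤ 1) (hεp : ε ≤ p) : BlockNorm (toB6 (geo9K i) R H) (XSK κ i → ℝ) :=
  BlockNorm.ofSmoothPartition (g := toB6 (geo9K i) R H) (fun y q => NearY i y q.1) (NearPair i) (wEta i ε) (wEta_nonneg i ε) (Wscl i p)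
    (Wscl_nonneg i p) (zetaOn i Prod.fst) (CLip d ℓ) (CLip_nonneg d ℓ) (fun q => sum_zetaOn_of_fintype i Prod.fst (toB6 (geo9K i) R H).fin q)
    (zetaOn_nonneg i Prod.fst) (zetaOn_le_one i Prod.fst) (fun y q h => zetaOn_eq_zero_of_not_nearY i Prod.fst y q h)
    (fun y q q' _ hP => (scaledWeight_mul_abs_zeta_sub_le i hε0 hε1 (Nat.cast_pos.2 (lt_of_lt_of_le Nat.zero_lt_one (one_le_nKT (toKT i)))) y q.1 q'.1
      (lt_of_lt_of_le one_pos (one_le_torusSupNorm_sub (toKT i) hP.1))).trans (mul_le_mul_of_nonneg_left (Wscl_mono i hεp y) (CLip_nonneg d ℓ)))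

variable {R : ℝ} {H : Prop} {ε p : ℝ} (hε0 : 0 ≤ ε) (hε1 : ε ≤ 1) (hεp : ε ≤ p)

omit [DecidableEq κ] in
/-- ★ **THE CUTTING COST IS MEMBER-UNIFORM**: `κ = 1 + C_Lip(d, L)`. [cite: Balaban1984PropagatorsII, (2.52) p.232; Balaban1985BackgroundPropagators, (3.43) p.398 («‖ζ‖^ξ_α + |ζ|»)] -/
theorem bHZ_κ : (bHZ (κ := κ) i (R := R) (H := H) hε0 hε1 hεp).κ = 1 + CLip d ℓ := rfl

omit [DecidableEq κ] in
/-- the cut-off is the multiplication by `ζ_y` read through the site projection. [cite: Balaban1985BackgroundPropagators, (3.43) p.398, bookkeeping] -/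
theorem bHZ_cut_apply (y : IBondY i) (F : XSK κ i → ℝ) (p : XSK κ i) :
    (bHZ (κ := κ) i (R := R) (H := H) hε0 hε1 hεp).cut y F p = zeta i y p.1 * F p := by
  classical
  exact ofSmoothPartition_cut_apply _ _ _

omit [DecidableEq κ] in
/-- localisation at `y` = the vector vanishes off the enlarged carrier block `Δ̃(y)` (through the site projection). [cite: Balaban1985BackgroundPropagators, (3.44) p.398 («supp λ ⊂ Δ̃(y′)»), bookkeeping] -/
theorem bHZ_isLoc_iff (y : IBondY i) (F : XSK κ i → ℝ) :
    (bHZ (κ := κ) i (R := R) (H := H) hε0 hε1 hεp).IsLoc y F ↔ ∀ p : XSK κ i, ¬ NearY i y p.1 → F p = 0 := by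
  classical
  exact ofSmoothPartition_isLoc_iff _ _

omit [DecidableEq κ] in
open Classical in
/-- the local size: `(Lʲη)^{−ε}·(sup over Δ̃(y)) + (weighted near-pair part based in Δ̃(y))`, read on the unrestricted vector.
[cite: Balaban1985BackgroundPropagators, (3.39)–(3.40) p.397 + (3.43) p.398, bookkeeping] -/
theorem bHZ_loc (y : IBondY i) (F : XSK κ i → ℝ) :
    (bHZ (κ := κ) i (R := R) (H := H) hε0 hε1 hεp).loc y F =
      Wscl i p y * (Size.ofSup (toB6 (geo9K i) R H) (fun (q : XSK κ i) (y : IBondY i) => NearY i y q.1)).sz y F +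
        (Size.ofPairs (toB6 (geo9K i) R H) (fun (q : XSK κ i) (y : IBondY i) => NearY i y q.1) (NearPair i) (wEta i ε) (wEta_nonneg i ε)).sz y F := by
  classical
  exact ofSmoothPartition_loc _ _

/-! ## §3 Sharp localisation implies smooth localisation -/

omit [DecidableEq κ] in
/-- a vector supported over the sites of the carrier block `β y` is localised at `y` in `bHZ` (the sites of `β y` lie in `Δ̃(y)`): the sharp classes' `IsLoc` (support in the
class of `y`) implies the smooth one. [cite: Balaban1985BackgroundPropagators, (3.44) p.398 («supp λ ⊂ Δ(y′)»), bookkeeping] -/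
theorem bHZ_isLoc_of_blkOf (y : IBondY i) (F : XSK κ i → ℝ) (hF : ∀ p : XSK κ i, blkOf i.D.toDomains p.1 ≠ β i.hN i.D i.hk y → F p = 0) :
    (bHZ (κ := κ) i (R := R) (H := H) hε0 hε1 hεp).IsLoc y F := by
  rw [bHZ_isLoc_iff]
  intro p hp
  by_contra hne
  exact hp (nearY_of_blkOf_eq i (by by_contra hb; exact hne (hF p hb)))

end Class

/-! ## §4 The ξ-scale twin: pair weight in units of the base point's block scale, sup power free (v1.1 append) -/

section Xi

variable (i : KIdx d ℓ hd hL b₀ b₁)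

/-- **THE ξ-SCALE PAIR WEIGHT** `((|z − z′|_T ∕ L^{lev z})^ε)⁻¹`: the Hölder quotient in units of the BASE POINT's block scale (def-Y's `tpar` on sites; print's `‖·‖^ξ_α`).
[cite: Balaban1985BackgroundPropagators, (3.43) p.398 («‖ζ‖^ξ_α»); Balaban1984PropagatorsII, (2.137) p.247] -/
def wXi (ε : ℝ) (p q : XSK κ i) : ℝ := ((torusSupNorm (toKT i).NB (p.1.1 - q.1.1) / (((ℓ + 1 : ℕ) : ℝ)) ^ levY i p.1) ^ ε)⁻¹

omit [Fintype κ] [DecidableEq κ] in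
/-- `0 ≤ wXi`. [cite: Balaban1985BackgroundPropagators, (3.43) p.398, bookkeeping] -/
theorem wXi_nonneg (ε : ℝ) (p q : XSK κ i) : 0 ≤ wXi i ε p q :=
  inv_nonneg.2 (Real.rpow_nonneg (div_nonneg (torusSupNorm_nonneg (fun μ => one_le_N0 (toKT i).hMh (toKT i).hP μ) _) (by positivity)) _)

omit [Fintype κ] [DecidableEq κ] in
/-- ★ the ξ-scale `hLip`: on `Δ̃(y)` the base point's block scale is at most `L·L^{j(y)}` (two-level window), so `wXi ε·|Δζ_y| ≤ L·C_Lip` for `0 ≤ ε ≤ 1` and distinct sites.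
[cite: Balaban1985BackgroundPropagators, (3.43) p.398 («‖ζ‖^ξ_α = O(1)»); Balaban1984PropagatorsII, (2.2) p.224] -/
theorem wXi_mul_abs_zeta_sub_le {ε : ℝ} (hε0 : 0 ≤ ε) (hε1 : ε ≤ 1) {y : IBondY i} {p : XSK κ i} (hN : NearY i y p.1) (q : XSK κ i)
    (hne : p.1.1 ≠ q.1.1) : wXi i ε p q * |zeta i y p.1 - zeta i y q.1| ≤ ((ℓ + 1 : ℕ) : ℝ) * CLip d ℓ := by
  have hL1 : (1 : ℝ) ≤ ((ℓ + 1 : ℕ) : ℝ) := by exact_mod_cast Nat.succ_le_succ (Nat.zero_le ℓ)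
  have hD : 0 < torusSupNorm (toKT i).NB (p.1.1 - q.1.1) := lt_of_lt_of_le one_pos (one_le_torusSupNorm_sub (toKT i) hne)
  have hs := scl_pos i y
  have hpow : (0 : ℝ) < (((ℓ + 1 : ℕ) : ℝ)) ^ levY i p.1 := by positivity
  -- the base point's scale against `L·L^{j(y)}`
  have hlev : (((ℓ + 1 : ℕ) : ℝ)) ^ levY i p.1 ≤ ((ℓ + 1 : ℕ) : ℝ) * scl i y := by
    rw [scl, ← pow_succ']; exact pow_le_pow_right₀ hL1 (B9MultiscaleSmoothPartitionY.levY_window_of_nearY i hN).2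
  -- compare the two weights: `wXi ≤ L^ε·((D∕scl)^ε)⁻¹ ≤ L·((D∕scl)^ε)⁻¹`
  set t := torusSupNorm (toKT i).NB (p.1.1 - q.1.1) / scl i y with ht
  have htpos : 0 < t := div_pos hD hs
  have hratio : t / ((ℓ + 1 : ℕ) : ℝ) ≤ torusSupNorm (toKT i).NB (p.1.1 - q.1.1) / (((ℓ + 1 : ℕ) : ℝ)) ^ levY i p.1 := by
    rw [ht, div_div, div_le_div_iff_of_pos_left hD (mul_pos hs (by positivity)) hpow]
    linarith
  have hw : wXi i ε p q ≤ ((ℓ + 1 : ℕ) : ℝ) * (t ^ ε)⁻¹ := by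
    unfold wXi
    have h1 : ((t / ((ℓ + 1 : ℕ) : ℝ)) ^ ε) ≤ (torusSupNorm (toKT i).NB (p.1.1 - q.1.1) / (((ℓ + 1 : ℕ) : ℝ)) ^ levY i p.1) ^ ε :=
      Real.rpow_le_rpow (div_nonneg htpos.le (by positivity)) hratio hε0
    have h2 : 0 < (t / ((ℓ + 1 : ℕ) : ℝ)) ^ ε := Real.rpow_pos_of_pos (div_pos htpos (by positivity)) _
    refine (inv_anti₀ h2 h1).trans ?_
    rw [Real.div_rpow htpos.le (by positivity), inv_div, div_eq_mul_inv]
    refine mul_le_mul_of_nonneg_right ?_ (inv_nonneg.2 (Real.rpow_nonneg htpos.le _))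
    calc (((ℓ + 1 : ℕ) : ℝ)) ^ ε ≤ (((ℓ + 1 : ℕ) : ℝ)) ^ (1 : ℝ) := Real.rpow_le_rpow_of_exponent_le hL1 hε1
      _ = _ := Real.rpow_one _
  have hxi := B9MultiscaleSmoothPartitionYLip.xiWeight_mul_abs_zeta_sub_le i hε0 hε1 y p.1 q.1 hD
  rw [← ht] at hxi
  calc wXi i ε p q * |zeta i y p.1 - zeta i y q.1| ≤ (((ℓ + 1 : ℕ) : ℝ) * (t ^ ε)⁻¹) * |zeta i y p.1 - zeta i y q.1| :=
      mul_le_mul_of_nonneg_right hw (abs_nonneg _)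
    _ = ((ℓ + 1 : ℕ) : ℝ) * ((t ^ ε)⁻¹ * |zeta i y p.1 - zeta i y q.1|) := by ring
    _ ≤ ((ℓ + 1 : ℕ) : ℝ) * CLip d ℓ := mul_le_mul_of_nonneg_left hxi (Nat.cast_nonneg _)

variable [Fintype (geo9K i).Site]

open Classical in
/-- ★★ **THE ξ-SCALE SMOOTH-PARTITION HÖLDER CLASS `bHZxi ε p`**: as `bHZ` but with the pair weight `wXi ε` (base point's block scale) and ANY sup power `p ≥ 0` (`W := Wscl p ≥ 1`),
`Λ := L·C_Lip(d, L)`; `κ = 1 + L·C_Lip` member-uniform. [cite: Balaban1985BackgroundPropagators, (3.40) p.397 + (3.43) p.398; Balaban1984PropagatorsII, (2.51)–(2.52) p.232, (2.137) p.247] -/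
def bHZxi {R : ℝ} {H : Prop} {ε p : ℝ} (hε0 : 0 ≤ ε) (hε1 : ε ≤ 1) (hp : 0 ≤ p) : BlockNorm (toB6 (geo9K i) R H) (XSK κ i → ℝ) :=
  BlockNorm.ofSmoothPartition (g := toB6 (geo9K i) R H) (fun y q => NearY i y q.1) (NearPair i) (wXi i ε) (wXi_nonneg i ε) (Wscl i p)
    (Wscl_nonneg i p) (zetaOn i Prod.fst) (((ℓ + 1 : ℕ) : ℝ) * CLip d ℓ) (mul_nonneg (Nat.cast_nonneg _) (CLip_nonneg d ℓ))
    (fun q => sum_zetaOn_of_fintype i Prod.fst (toB6 (geo9K i) R H).fin q)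
    (zetaOn_nonneg i Prod.fst) (zetaOn_le_one i Prod.fst) (fun y q h => zetaOn_eq_zero_of_not_nearY i Prod.fst y q h)
    (fun y _ q' hNq hP => (wXi_mul_abs_zeta_sub_le i hε0 hε1 hNq q' hP.1).trans
      (le_mul_of_one_le_right (mul_nonneg (Nat.cast_nonneg _) (CLip_nonneg d ℓ)) (one_le_Wscl i hp y)))

omit [DecidableEq κ] in
/-- its cutting cost: `κ = 1 + L·C_Lip(d, L)`. [cite: Balaban1984PropagatorsII, (2.52) p.232; Balaban1985BackgroundPropagators, (3.43) p.398] -/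
theorem bHZxi_κ {R : ℝ} {H : Prop} {ε p : ℝ} (hε0 : 0 ≤ ε) (hε1 : ε ≤ 1) (hp : 0 ≤ p) :
    (bHZxi (κ := κ) i (R := R) (H := H) hε0 hε1 hp).κ = 1 + ((ℓ + 1 : ℕ) : ℝ) * CLip d ℓ := rfl

omit [DecidableEq κ] in
/-- localisation in `bHZxi` = vanishing off `Δ̃(y)` (same as `bHZ`). [cite: Balaban1985BackgroundPropagators, (3.44) p.398, bookkeeping] -/
theorem bHZxi_isLoc_iff {R : ℝ} {H : Prop} {ε p : ℝ} (hε0 : 0 ≤ ε) (hε1 : ε ≤ 1) (hp : 0 ≤ p) (y : IBondY i) (F : XSK κ i → ℝ) :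
    (bHZxi (κ := κ) i (R := R) (H := H) hε0 hε1 hp).IsLoc y F ↔ ∀ q : XSK κ i, ¬ NearY i y q.1 → F q = 0 := by
  classical
  exact ofSmoothPartition_isLoc_iff _ _

end Xi

end Literature.MathematicalPhysics.QuantumFieldTheory.Balaban1983to89.B9SmoothHolderClassS
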